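import Summits.HodgeConjecture.HodgeConjecture.Theorems.VHCAbelianSchemesRoadSecantQuotientAnchorTransport
import Literature.AlgebraicGeometry.Markman2025.SecantQuotientPolarization
import HarnessLib

/-!
# Road b02 (`VHCAbelianSchemesRoad`, D-0059) — the secant–quotient anchor of the `(6,3)` rung WITH ITS POLARISATION PINNED
# to the descended Weil class `h_Y(θ₀)` (skeleton v3.1 of crux `SemiregularSheafRepresentativesTwAtDiag`, item
# stmt-HodgeConjecture-19787): the pinned anchor predicate, (a″) the pinned anchored-carrier statement, (b″) the pinned
# residual, fact-free glue and the comparison with v3's (a′) ∕ (b′)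

research route conditional on HC_CM; not a corollary; Q11.4-sentence-2 already refuted in dim ≥ 3.

DEFINITIONS AND FACT-FREE GLUE ONLY (`HC_CM` nowhere; no cell, carrier, residual, K-SR♭∃, VHC, `HC_AV` or HC asserted; no
claim-tagged fact imported). Ring-2 ruling L153.1a (v3.1 = GO; design memo of LEAD 152): v3's geometric anchor predicate
`IsSecantQuotientWeilClassAt X θ γ` (`VHCAbelianSchemesRoadSecantQuotientAnchorDefs`, p506550) lets the polarisation class `θ`
be ANY ample-line class making `(J × Ĵ, φ_d)` hyperbolic for `q^*θ` — gap (G2) against print, where Markman polarises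
`Y_d = (J × Ĵ)/Ḡ` by the descent `h` of the `Spin(V)_P`-invariant class `Ξ_P` (arXiv:2502.03415 §1.3, §2.4, Prop. 2.4.4).
The carriers file `Literature/AlgebraicGeometry/Markman2025/SecantQuotientPolarization` (p507939) types that descent in
closed form: `Ξ_d(θ₀) = p₁^*θ₀ + d·p₂^*θ̂₀` (`weilPolarizationClass`) and its descent `h_Y(θ₀)` to the secant quotient
(`secantPolarizationClass`, `q^*h_Y(θ₀) = Ξ_d(θ₀)`), for a polarisation class `θ₀` OF the theta divisor
(`AbelianVariety.IsPolarizationClassOf Θ θ₀`: rational, non-zero, on the line of `ch(Θ)`); and b02's pinned object-level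
claim-fact `HodgeTheory.Markman2025_secantQuotient_twistedCarrier_onJacobian_pinned` (p510628, PREPRINT, under review) is
stated AT `h_Y(θ₀)`. THIS file narrows the road's anchor accordingly — NEW NAMES ONLY, nothing of v3 edited in place:

* `SecantQuotientDatum.hY D θ₀ := secantPolarizationClass D.𝒥.J … D.d θ₀ ∈ H²(D.Y)` — the descended Weil polarisation of
  the datum, `q^*(hY θ₀) = Ξ_d(θ₀)` (`complexBetti_map_q_hY`).
* `IsSecantQuotientWeilClassAtPinned X θ γ` := v3's clauses VERBATIM (chart `e : X ≅ D.Y.X`; `θ` a polarisation class on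
  `X`; `e⁻¹^*θ` on the line of an ample divisor of `D.Y`; `(J × Ĵ, φ_d)` hyperbolic for `q^*e⁻¹^*θ`; `γ` rational, off
  `ℂ·θ³`, `q^*e⁻¹^*γ` a Weil class) PLUS THE PIN `∃ θ₀, IsPolarizationClassOf D.Θ θ₀ ∧ e⁻¹^*θ = D.hY θ₀`. The ample-line
  and hyperbolicity clauses are KEPT (they are not consequences of the pin on current carriers: ampleness of the descent of
  `Ξ` along `q` and Lemma 3.1.3's discriminant are not typed), so `…Pinned → …At` is a projection (`toAt`).
  `secantQuotientServedClassesPinned`, `secantQuotientAnchorsPinned` — the anchor data `(𝔄^pin, 𝔖^pin)`.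
* (a″) `SecantQuotientAnchorCarrier63Pinned C := AnchoredCarrierAt (tw C AdmTw) 6 3 𝔄^pin 𝔖^pin` and (b″)
  `SecantQuotientResidual63Pinned C := LefAtExceptionalRegimeAtUnder (tw C AdmTw) 6 3 (¬ HasServedFibre 6 3 𝔄^pin 𝔖^pin)`,
  `tw C AdmTw` the crux's twisted door verbatim; both `@[conjecture]`, OPEN, HYPOTHESES wherever used.
* §4 fact-free glue by name: (a″) ∧ (b″) ⟹ the registered `(6,3)` rung; the rung ⟹ (b″) (same AA-b ∕ AA-d names as v3).
* §5 COMPARISON (honest bookkeeping of what the pin moves): `𝔄^pin ≤ 𝔄`, `𝔖^pin ⊆ 𝔖`, hence **(a′) ⟹ (a″)** (fewer anchors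
  and served classes: `anchoredCarrierAt_anti`) and **(b″) ⟹ (b′)** (MORE pencils have no pinned-served fibre:
  `under_not_hasServedFibre_mono`). So v3.1 moves content from the citation-expected half (a) to the research half (b);
  neither converse is claimed.
* §6 transport of the pinned predicate along isomorphisms (the pin is a `Y`-side clause, unchanged under re-charting) and
  the served-fibre-from-a-chart lemma in pinned form (what a pinned P1″ consumes), verbatim the P2 pattern of
  `VHCAbelianSchemesRoadSecantQuotientAnchorTransport` (p507863); §7 the link to the carriers' scheme-level anchor shape
  `Markman2025.IsSecantQuotientAnchorWith D.d X θ` (so F5's API — smooth projective, `θ` rational `(1,1)` algebraic `≠ 0` —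
  applies at every pinned anchor).

HONEST GAPS left against print after the pin (carried as (a″)'s «why it might fail»): (G1) generic NON-HYPERELLIPTIC genus-3
`C` is not typable (envelope narrowed only by Lemma 9.3.1's general position); (G3) print serves ONE direction per anchor (the
Weil component of `κ₃(𝓔̄)`), `𝔖^pin` is every rational class of `ℂθ³ ⊕ (Weil plane)` off the ray. (G2) is CLOSED at
statement level up to the sign ∕ `ℚˣ` conventions recorded in the docstring of the pinned claim-fact (transport along `σ̄`).

What is NOT claimed: (a″), (b″), (a′), (b′), any cell, the rung, the crux, K-SR♭∃, VHC, `HC_AV`, HC; that `𝔄^pin` is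
inhabited (that is b02's P1″ modulo the pinned claim-fact); any converse of §5. References: [cite: Markman2025SecantWeil,
§1.3 (p. 5), §1.5 (p. 7), Thm. 1.4.1, §2.4 Prop. 2.4.4, Lemma 3.1.3, §3.2 Cor. 3.2.3, §9.2 Prop. 9.2.2, §9.3 Lemma 9.3.1 and
Lemma 9.3.11] [cite: Bloch1972Semiregularity, Remark (7.5)] [cite: vanGeemen1994HodgeAV, §3.6, Lemma 5.2, 5.4 and Thm. 4.11]
[cite: MumfordAV1970, §7 Thm. 4 p. 72].
-/

noncomputable section

open CategoryTheory CategoryTheory.Limits AlgebraicGeometry Topology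

namespace Summit.HodgeConjecture.HodgeConjecture.Ring2.SemiregularRepresentatives

set_option linter.dupNamespace false -- the cell's namespace repeats the summit name, as in every `Ring2*` file

open Literature.AlgebraicGeometry Literature.AlgebraicGeometry.Motives Literature.AlgebraicGeometry.Motives.AbelianVariety
open Literature.AlgebraicGeometry.HodgeTheory Literature.AlgebraicGeometry.Markman2025
open Literature.AlgebraicTopology.SingularHomology
open Summit.Ventures.HSemireg (ObjClass)

/-! ## §1 The descended Weil polarisation `h_Y(θ₀)` of a secant–quotient datum -/

namespace SecantQuotientDatum

variable (D : SecantQuotientDatum)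

/-- **`h_Y(θ₀)`, the DESCENDED WEIL POLARISATION CLASS of the datum**: the descent to `D.Y = (J × Ĵ)/Ḡ` of
`Ξ_d(θ₀) = p₁^*θ₀ + d·p₂^*θ̂₀` (`Markman2025.secantPolarizationClass` at the datum's fields). For `θ₀ = c·[Θ]`, `c ∈ ℚˣ`,
this is print's `h` transported along `σ̄` (docstring of `HodgeTheory.Markman2025_secantQuotient_twistedCarrier_onJacobian_pinned`).
[cite: Markman2025SecantWeil, §1.3 (p. 5), §1.5 (p. 7) and §3.2 Cor. 3.2.3] -/
def hY (θ₀ : complexBetti D.𝒥.J.X 2) : complexBetti D.Y.X 2 :=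
  secantPolarizationClass D.𝒥.J D.isAmple D.G₁ D.G₂ D.succ_ne_zero D.G₁_le D.G₂_le D.d θ₀

/-- `hY` unfolded (definitional). [cite: Markman2025SecantWeil, §1.5 (p. 7)] -/
theorem hY_def (θ₀ : complexBetti D.𝒥.J.X 2) :
    D.hY θ₀ = secantPolarizationClass D.𝒥.J D.isAmple D.G₁ D.G₂ D.succ_ne_zero D.G₁_le D.G₂_le D.d θ₀ := rfl

/-- **The defining equation `q^*h_Y(θ₀) = Ξ_d(θ₀) = p₁^*θ₀ + d·p₂^*θ̂₀`.**
[cite: Markman2025SecantWeil, §9.3 (proof of Lemma 9.3.11: q^* is an isomorphism)] -/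
theorem complexBetti_map_q_hY (θ₀ : complexBetti D.𝒥.J.X 2) :
    complexBetti.map D.q.hom.hom.hom 2 (D.hY θ₀) = weilPolarizationClass D.𝒥.J D.isAmple D.d θ₀ :=
  complexBetti_map_secantQuotientMap_secantPolarizationClass D.𝒥.J D.isAmple D.G₁ D.G₂ D.succ_ne_zero D.G₁_le D.G₂_le D.d θ₀

end SecantQuotientDatum

/-! ## §2 The PINNED anchor predicate and its served classes -/

/-- **`γ` is a secant–quotient Weil class on `(X, θ)` AT THE PINNED POLARISATION (`IsSecantQuotientWeilClassAtPinned X θ γ`)**: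
v3's `IsSecantQuotientWeilClassAt X θ γ` — a datum `D`, a chart `e : X ≅ D.Y.X`, `θ` a polarisation class on `X` whose
transport to `D.Y` is on the line of an ample divisor and makes `(J × Ĵ, φ_d)` hyperbolic for `q^*θ`, `γ` rational, off
`ℂ·θ³`, with `q^*γ` a Weil class of `(J × Ĵ, φ_d)` — TOGETHER WITH THE PIN: a polarisation class `θ₀` of the theta divisor
(`IsPolarizationClassOf D.Θ θ₀`) with **`e⁻¹^*θ = h_Y(θ₀)`**. Closes road gap (G2) at statement level; (G1) and (G3) remain
(module docstring). [cite: Markman2025SecantWeil, §1.3 (p. 5), §1.5 (p. 7), Thm. 1.4.1, §2.4 Prop. 2.4.4 and Lemma 3.1.3]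
[cite: vanGeemen1994HodgeAV, Lemma 5.2 and 5.4] -/
def IsSecantQuotientWeilClassAtPinned (X : SchemeOver ℂ) (θ : complexBetti X 2) (γ : complexBetti X (2 * 3)) : Prop :=
  ∃ (D : SecantQuotientDatum) (e : X ≅ D.Y.X) (θ₀ : complexBetti D.𝒥.J.X 2),
    D.𝒥.J.IsPolarizationClassOf D.Θ θ₀ ∧ complexBetti.map e.inv 2 θ = D.hY θ₀ ∧
    IsPolarizationClass 6 X θ ∧
    (∃ H : CartierDivisor D.Y.X.left, H.IsAmple ∧ D.Y.IsPolarizationClassOf H (complexBetti.map e.inv 2 θ)) ∧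
    IsHyperbolicWeilType D.P D.ψ 3 (complexBetti.map D.q.hom.hom.hom 2 (complexBetti.map e.inv 2 θ)) ∧
    IsRationalClass γ ∧ γ ∉ (ℂ ∙ cupPowTwo θ 3) ∧
    complexBetti.map D.q.hom.hom.hom (2 * 3) (complexBetti.map e.inv (2 * 3) γ) ∈ weilClassesOf D.P D.ψ 3 D.d

/-- **The PINNED served classes**: `𝔖^pin X θ := {γ | IsSecantQuotientWeilClassAtPinned X θ γ}`.
[cite: Markman2025SecantWeil, Thm. 1.4.1 and §1.5] -/
def secantQuotientServedClassesPinned (X : SchemeOver ℂ) (θ : complexBetti X 2) : Set (complexBetti X (2 * 3)) :=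
  {γ | IsSecantQuotientWeilClassAtPinned X θ γ}

/-- **`(X, θ)` is a PINNED secant–quotient anchor**: some class is a pinned secant–quotient Weil class on `(X, θ)` — `X` is a
chart of a secant quotient `Y_d` polarised by `θ = e^*h_Y(θ₀)`. NO output clause. [cite: Markman2025SecantWeil, §1.5 (p. 7) and Thm. 1.4.1] -/
def secantQuotientAnchorsPinned (X : SchemeOver ℂ) (θ : complexBetti X 2) : Prop :=
  ∃ γ : complexBetti X (2 * 3), IsSecantQuotientWeilClassAtPinned X θ γ

variable {X X' : SchemeOver ℂ} {θ : complexBetti X 2} {γ : complexBetti X (2 * 3)}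

/-- Membership in the pinned served set, unfolded (definitional). [cite: Markman2025SecantWeil, Thm. 1.4.1] -/
theorem mem_secantQuotientServedClassesPinned_iff :
    γ ∈ secantQuotientServedClassesPinned X θ ↔ IsSecantQuotientWeilClassAtPinned X θ γ := Iff.rfl

/-- The pinned anchor predicate, unfolded (definitional). [cite: Markman2025SecantWeil, §1.5 (p. 7)] -/
theorem secantQuotientAnchorsPinned_iff :
    secantQuotientAnchorsPinned X θ ↔ ∃ γ, γ ∈ secantQuotientServedClassesPinned X θ := Iff.rfl

/-- A pinned served class witnesses the pinned anchor. [cite: Markman2025SecantWeil, §1.5 (p. 7)] -/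
theorem secantQuotientAnchorsPinned_of_mem (h : γ ∈ secantQuotientServedClassesPinned X θ) :
    secantQuotientAnchorsPinned X θ := ⟨γ, h⟩

namespace IsSecantQuotientWeilClassAtPinned

/-- **Forgetting the pin**: a pinned secant–quotient Weil class is a secant–quotient Weil class in v3's sense (the v3 clauses
are carried verbatim). [cite: Markman2025SecantWeil, Thm. 1.4.1] -/
theorem toAt (h : IsSecantQuotientWeilClassAtPinned X θ γ) : IsSecantQuotientWeilClassAt X θ γ := by
  obtain ⟨D, e, θ₀, -, -, hpol, hamp, hW, hγ, hray, hmem⟩ := h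
  exact ⟨D, e, hpol, hamp, hW, hγ, hray, hmem⟩

/-- The pin alone: a datum, a chart and a polarisation class `θ₀` of `Θ` with `e⁻¹^*θ = h_Y(θ₀)`.
[cite: Markman2025SecantWeil, §1.3 (p. 5) and §3.2 Cor. 3.2.3] -/
theorem exists_pin (h : IsSecantQuotientWeilClassAtPinned X θ γ) :
    ∃ (D : SecantQuotientDatum) (e : X ≅ D.Y.X) (θ₀ : complexBetti D.𝒥.J.X 2),
      D.𝒥.J.IsPolarizationClassOf D.Θ θ₀ ∧ complexBetti.map e.inv 2 θ = D.hY θ₀ := by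
  obtain ⟨D, e, θ₀, hθ₀, hpin, -⟩ := h
  exact ⟨D, e, θ₀, hθ₀, hpin⟩

/-- `θ` is a polarisation class on `X`. [cite: Markman2025SecantWeil, §2.4] -/
theorem isPolarizationClass (h : IsSecantQuotientWeilClassAtPinned X θ γ) : IsPolarizationClass 6 X θ :=
  h.toAt.isPolarizationClass

/-- `γ` is rational. [cite: Markman2025SecantWeil, Thm. 1.4.1] -/
theorem isRationalClass (h : IsSecantQuotientWeilClassAtPinned X θ γ) : IsRationalClass γ := h.toAt.isRationalClass

/-- `γ` is off the ray `ℂ·θ³`. [cite: Markman2025SecantWeil, Thm. 1.4.1 (item 4)] -/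
theorem not_mem_span (h : IsSecantQuotientWeilClassAtPinned X θ γ) : γ ∉ (ℂ ∙ cupPowTwo θ 3) := h.toAt.not_mem_span

/-- A variety carrying a pinned secant–quotient Weil class is a smooth projective sixfold. [cite: Markman2025SecantWeil, §1.5 (p. 7)] -/
theorem isSmoothProjective (h : IsSecantQuotientWeilClassAtPinned X θ γ) : IsSmoothProjective 6 X :=
  h.toAt.isSmoothProjective

/-- The underlying variety is (a chart of) an abelian sixfold. [cite: Markman2025SecantWeil, §1.5 (p. 7)] -/
theorem exists_abelianVariety (h : IsSecantQuotientWeilClassAtPinned X θ γ) :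
    ∃ A : AbelianVariety ℂ, A.dim = 6 ∧ Nonempty (A.X ≅ X) :=
  h.toAt.exists_abelianVariety

/-- **INTRODUCTION AT THE IDENTITY CHART** (the form a pinned P1″ uses): on `D.Y.X` itself, at `θ = h_Y(θ₀)` for a polarisation
class `θ₀` of `Θ`, the v3 clauses for `(h_Y(θ₀), γ)` give a pinned secant–quotient Weil class.
[cite: Markman2025SecantWeil, §1.5 (p. 7), Thm. 1.4.1 and §3.2 Cor. 3.2.3] -/
theorem of_refl (D : SecantQuotientDatum) {θ₀ : complexBetti D.𝒥.J.X 2} (hθ₀ : D.𝒥.J.IsPolarizationClassOf D.Θ θ₀)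
    {γ : complexBetti D.Y.X (2 * 3)} (hpol : IsPolarizationClass 6 D.Y.X (D.hY θ₀))
    (hamp : ∃ H : CartierDivisor D.Y.X.left, H.IsAmple ∧ D.Y.IsPolarizationClassOf H (D.hY θ₀))
    (hW : IsHyperbolicWeilType D.P D.ψ 3 (complexBetti.map D.q.hom.hom.hom 2 (D.hY θ₀)))
    (hγ : IsRationalClass γ) (hray : γ ∉ (ℂ ∙ cupPowTwo (D.hY θ₀) 3))
    (hmem : complexBetti.map D.q.hom.hom.hom (2 * 3) γ ∈ weilClassesOf D.P D.ψ 3 D.d) :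
    IsSecantQuotientWeilClassAtPinned D.Y.X (D.hY θ₀) γ := by
  have hid2 : complexBetti.map (Iso.refl D.Y.X).inv 2 (D.hY θ₀) = D.hY θ₀ := by
    rw [Iso.refl_inv, complexBetti.map_id]; rfl
  have hid6 : complexBetti.map (Iso.refl D.Y.X).inv (2 * 3) γ = γ := by
    rw [Iso.refl_inv, complexBetti.map_id]; rfl
  refine ⟨D, Iso.refl _, θ₀, hθ₀, hid2, hpol, ?_, ?_, hγ, hray, ?_⟩
  · rw [hid2]; exact hamp
  · rw [hid2]; exact hW
  · rw [hid6]; exact hmem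

/-- **TRANSPORT along an isomorphism `e' : X' ≅ X`** (the P2 pattern): the chart composes, the pin and the other `Y`-side
clauses are unchanged because `((e' ≪≫ e)⁻¹)^* (e'^* x) = (e⁻¹)^* x`, the `X`-side clauses move by
`IsPolarizationClass.map_of_iso`, `IsRationalClass.map`, `map_not_mem_span_cupPowTwo_of_iso`.
[cite: Andre1996Motifs, §1.1 (p. 10)] [cite: Markman2025SecantWeil, Thm. 1.4.1] -/
theorem of_iso (e' : X' ≅ X) (h : IsSecantQuotientWeilClassAtPinned X θ γ) :
    IsSecantQuotientWeilClassAtPinned X' (complexBetti.map e'.hom 2 θ) (complexBetti.map e'.hom (2 * 3) γ) := by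
  have hX : IsSmoothProjective 6 X := h.isSmoothProjective
  have hX' : IsSmoothProjective 6 X' := hX.of_iso e'.symm
  obtain ⟨D, e, θ₀, hθ₀, hpin, hpol, hamp, hW, hγQ, hray, hmem⟩ := h
  have key : ∀ (k : ℕ) (x : complexBetti X k),
      complexBetti.map (e' ≪≫ e).inv k (complexBetti.map e'.hom k x) = complexBetti.map e.inv k x := by
    intro k x
    rw [Iso.trans_inv, complexBetti.map_comp, ModuleCat.comp_apply, e'.complexBetti_map_inv_map_hom]
  refine ⟨D, e' ≪≫ e, θ₀, hθ₀, ?_, hpol.map_of_iso hX hX' e', ?_, ?_, hγQ.map _,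
    map_not_mem_span_cupPowTwo_of_iso e' hray, ?_⟩
  · rw [key]; exact hpin
  · rw [key]; exact hamp
  · rw [key]; exact hW
  · rw [key]; exact hmem

end IsSecantQuotientWeilClassAtPinned

/-! ## §3 The `(6,3)` PINNED anchored-carrier statement (a″) and PINNED residual (b″) for the crux's twisted door -/

/-- **(a″) THE PINNED SECANT–QUOTIENT ANCHORED-CARRIER STATEMENT at `(6,3)` for the crux's twisted door `tw C AdmTw`
(`SecantQuotientAnchorCarrier63Pinned C`)**: at every PINNED anchor `(X, e^*h_Y(θ₀))` and every pinned served rational class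
`γ`, an `AdmTw`-admissible `B`-twisted bounded complex of vector bundles ON `X` with `κ₃ = a·γ + c₃·θ³`, `a ≠ 0`,
`κ_k = c_k·θᵏ` (`k ∈ I ∖ {3}`) — `AnchoredCarrierAt` at `(𝔄^pin, 𝔖^pin)`. CITATION-EXPECTED from a PREPRINT at print's
anchors in print's direction (arXiv:2502.03415 Thm. 1.4.1 + §1.5 + Lemma 9.3.11 + Remark 9.3.7; the pinned object-level
claim-tagged fact `HodgeTheory.Markman2025_secantQuotient_twistedCarrier_onJacobian_pinned`); implied by v3's (a′)
(`secantQuotientAnchorCarrier63Pinned_of_secantQuotientAnchorCarrier63`); OPEN beyond by the gaps (G1) genericity and (G3) served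
directions — WHY IT MIGHT FAIL: at special (e.g. hyperelliptic) curves the secant sheaf may fail to be reflexive of rank `8d`
(Prop. 9.2.2), and no carrier is in print for Weil directions other than `κ₃(𝓔̄)`'s. A HYPOTHESIS wherever used.
[cite: Markman2025SecantWeil, Thm. 1.4.1, §1.5, §9.2 Prop. 9.2.2 and Lemma 9.3.11] [cite: Bloch1972Semiregularity, Remark (7.5)] -/
@[conjecture] def SecantQuotientAnchorCarrier63Pinned (C : ChernCharacterBetti) : Prop :=
  AnchoredCarrierAt (Literature.AlgebraicGeometry.HodgeTheory.twistedReflexiveClass C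
      (fun n X₀ I E => Summit.Ventures.HSemireg.gluableSigmaAdmissible n X₀ I E ∨
        Literature.AlgebraicGeometry.HodgeTheory.bfSingleAdmissible n X₀ I E)) 6 3
    (fun X θ ↦ secantQuotientAnchorsPinned X θ) (fun X θ ↦ secantQuotientServedClassesPinned X θ)

/-- **(b″) THE PINNED SECANT–QUOTIENT RESIDUAL at `(6,3)` for the crux's twisted door (`SecantQuotientResidual63Pinned C`)**:
the cell `LefAtExceptionalRegimeAt (tw C AdmTw) 6 3` RESTRICTED to the one-parameter abelian sixfold pencils `(f, W)` with NO
PINNED-served fibre (`¬ HasServedFibre 6 3 𝔄^pin 𝔖^pin f W`). A LARGER family than v3's (b′) (pencils served only at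
un-pinned polarisations are residual here): (b″) ⟹ (b′) (`secantQuotientResidual63_of_secantQuotientResidual63Pinned`), the
converse is NOT claimed. Implied by the rung fact-free (§4); NOT known to imply it. OPEN; a HYPOTHESIS wherever used; skeleton
v3.1's T3 designate. [cite: vanGeemen1994HodgeAV, §2.4, Thm. 4.11 and 5.4] [cite: Markman2025SecantWeil, §1.5 and Thm. 1.5.1]
[cite: Bloch1972Semiregularity, Remark (7.5)] -/
@[conjecture] def SecantQuotientResidual63Pinned (C : ChernCharacterBetti) : Prop :=
  LefAtExceptionalRegimeAtUnder (Literature.AlgebraicGeometry.HodgeTheory.twistedReflexiveClass C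
      (fun n X₀ I E => Summit.Ventures.HSemireg.gluableSigmaAdmissible n X₀ I E ∨
        Literature.AlgebraicGeometry.HodgeTheory.bfSingleAdmissible n X₀ I E)) 6 3
    (fun _ _ f W ↦ ¬ HasServedFibre 6 3 (fun X θ ↦ secantQuotientAnchorsPinned X θ)
      (fun X θ ↦ secantQuotientServedClassesPinned X θ) f W)

/-! ## §4 Fact-free glue by name (route-independent): (a″) ∧ (b″) ⟹ rung; rung ⟹ (b″) -/

/-- **(a″) ∧ (b″) ⟹ the registered `(6,3)` rung** `∀ C, LefAtExceptionalRegimeSixfoldMiddle (tw C AdmTw)` (skeleton stub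
`stub_rung_sixfoldMiddleTw`'s statement, byte-identical), by `lefAtExceptionalRegimeSixfoldMiddle_of_anchoredCarrierAt_of_under_not`.
[cite: Markman2025SecantWeil, Thm. 1.4.1 and Thm. 1.5.1] [cite: Bloch1972Semiregularity, Remark (7.5)] [cite: vanGeemen1994HodgeAV, Thm. 4.11] -/
theorem rung_sixfoldMiddleTw_of_secantQuotientAnchorCarrier63Pinned_of_residual63Pinned
    (hA : ∀ C : ChernCharacterBetti, SecantQuotientAnchorCarrier63Pinned C)
    (hR : ∀ C : ChernCharacterBetti, SecantQuotientResidual63Pinned C) :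
    ∀ C : ChernCharacterBetti, LefAtExceptionalRegimeSixfoldMiddle (Literature.AlgebraicGeometry.HodgeTheory.twistedReflexiveClass C
      (fun n X₀ I E => Summit.Ventures.HSemireg.gluableSigmaAdmissible n X₀ I E ∨
        Literature.AlgebraicGeometry.HodgeTheory.bfSingleAdmissible n X₀ I E)) :=
  fun C ↦ lefAtExceptionalRegimeSixfoldMiddle_of_anchoredCarrierAt_of_under_not (hA C) (hR C)

/-- **The rung ⟹ (b″)** (a residual is a cell under an extra hypothesis). [cite: vanGeemen1994HodgeAV, §2.4] [cite: Bloch1972Semiregularity, Remark (7.5)] -/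
theorem secantQuotientResidual63Pinned_of_rung_sixfoldMiddleTw {C : ChernCharacterBetti}
    (h : LefAtExceptionalRegimeSixfoldMiddle (Literature.AlgebraicGeometry.HodgeTheory.twistedReflexiveClass C
      (fun n X₀ I E => Summit.Ventures.HSemireg.gluableSigmaAdmissible n X₀ I E ∨
        Literature.AlgebraicGeometry.HodgeTheory.bfSingleAdmissible n X₀ I E))) :
    SecantQuotientResidual63Pinned C :=
  under_of_lefAtExceptionalRegimeAt _ (lefAtExceptionalRegimeSixfoldMiddle_iff_at.1 h)

/-! ## §5 Comparison with v3: `𝔄^pin ≤ 𝔄`, `𝔖^pin ⊆ 𝔖`; (a′) ⟹ (a″); (b″) ⟹ (b′) -/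

/-- Pinned anchors are anchors. [cite: Markman2025SecantWeil, §1.5 (p. 7)] -/
theorem secantQuotientAnchors_of_pinned : ∀ (X : SchemeOver ℂ) (θ : complexBetti X 2),
    secantQuotientAnchorsPinned X θ → secantQuotientAnchors X θ :=
  fun _ _ ⟨γ, hγ⟩ ↦ ⟨γ, hγ.toAt⟩

/-- Pinned served classes are served classes (at any `(X, θ)`; the anchor hypothesis is the shape the monotonicity lemmas take).
[cite: Markman2025SecantWeil, Thm. 1.4.1] -/
theorem secantQuotientServedClasses_of_pinned : ∀ (X : SchemeOver ℂ) (θ : complexBetti X 2),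
    secantQuotientAnchorsPinned X θ → secantQuotientServedClassesPinned X θ ⊆ secantQuotientServedClasses X θ :=
  fun _ _ _ _ hγ ↦ IsSecantQuotientWeilClassAtPinned.toAt hγ

/-- A pinned-served fibre is a served fibre. [cite: Bloch1972Semiregularity, Remark (7.5)] [cite: Markman2025SecantWeil, Thm. 1.4.1] -/
theorem hasServedFibre_secantQuotient_of_pinned {𝒳 S : SchemeOver ℂ} {f : 𝒳 ⟶ S} {W : complexBetti 𝒳 (2 * 3)}
    (h : HasServedFibre 6 3 (fun X θ ↦ secantQuotientAnchorsPinned X θ) (fun X θ ↦ secantQuotientServedClassesPinned X θ) f W) :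
    HasServedFibre 6 3 (fun X θ ↦ secantQuotientAnchors X θ) (fun X θ ↦ secantQuotientServedClasses X θ) f W :=
  hasServedFibre_mono secantQuotientAnchors_of_pinned secantQuotientServedClasses_of_pinned W h

/-- **(a′) ⟹ (a″)**: the pinned anchored-carrier statement asks for carriers at FEWER anchors and classes (`anchoredCarrierAt_anti`).
[cite: Bloch1972Semiregularity, Remark (7.5)] [cite: Markman2025SecantWeil, Thm. 1.4.1] -/
theorem secantQuotientAnchorCarrier63Pinned_of_secantQuotientAnchorCarrier63 {C : ChernCharacterBetti}
    (h : SecantQuotientAnchorCarrier63 C) : SecantQuotientAnchorCarrier63Pinned C :=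
  anchoredCarrierAt_anti secantQuotientAnchors_of_pinned secantQuotientServedClasses_of_pinned h

/-- **(b″) ⟹ (b′)**: the pinned residual quantifies over MORE pencils (`under_not_hasServedFibre_mono`). The converse is NOT claimed.
[cite: Bloch1972Semiregularity, Remark (7.5)] [cite: vanGeemen1994HodgeAV, §2.4] -/
theorem secantQuotientResidual63_of_secantQuotientResidual63Pinned {C : ChernCharacterBetti}
    (h : SecantQuotientResidual63Pinned C) : SecantQuotientResidual63 C :=
  under_not_hasServedFibre_mono secantQuotientAnchors_of_pinned secantQuotientServedClasses_of_pinned h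

/-- (a′) ∧ (b″) ⟹ the rung (mixed form: v3's anchored-carrier statement with the pinned residual). [cite: Bloch1972Semiregularity, Remark (7.5)]
[cite: Markman2025SecantWeil, Thm. 1.4.1 and Thm. 1.5.1] -/
theorem rung_sixfoldMiddleTw_of_secantQuotientAnchorCarrier63_of_residual63Pinned
    (hA : ∀ C : ChernCharacterBetti, SecantQuotientAnchorCarrier63 C)
    (hR : ∀ C : ChernCharacterBetti, SecantQuotientResidual63Pinned C) :
    ∀ C : ChernCharacterBetti, LefAtExceptionalRegimeSixfoldMiddle (Literature.AlgebraicGeometry.HodgeTheory.twistedReflexiveClass C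
      (fun n X₀ I E => Summit.Ventures.HSemireg.gluableSigmaAdmissible n X₀ I E ∨
        Literature.AlgebraicGeometry.HodgeTheory.bfSingleAdmissible n X₀ I E)) :=
  rung_sixfoldMiddleTw_of_secantQuotientAnchorCarrier63Pinned_of_residual63Pinned
    (fun C ↦ secantQuotientAnchorCarrier63Pinned_of_secantQuotientAnchorCarrier63 (hA C)) hR

/-! ## §6 Transport of the pinned anchor data and the served fibre from a chart (pinned P2) -/

/-- Pinned served classes transport: `w ∈ 𝔖^pin X θ ⟹ (e⁻¹)^* w ∈ 𝔖^pin X' ((e⁻¹)^* θ)` for `e : X ≅ X'`. [cite: Markman2025SecantWeil, Thm. 1.4.1] -/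
theorem secantQuotientServedClassesPinned_transport (e : X ≅ X') {w : complexBetti X (2 * 3)}
    (hw : w ∈ secantQuotientServedClassesPinned X θ) :
    complexBetti.map e.inv (2 * 3) w ∈ secantQuotientServedClassesPinned X' (complexBetti.map e.inv 2 θ) :=
  IsSecantQuotientWeilClassAtPinned.of_iso e.symm hw

/-- Pinned anchors transport: `𝔄^pin X θ ⟹ 𝔄^pin X' ((e⁻¹)^* θ)` for `e : X ≅ X'`. [cite: Markman2025SecantWeil, §1.5 (p. 7)] -/
theorem secantQuotientAnchorsPinned_transport (e : X ≅ X') (h : secantQuotientAnchorsPinned X θ) :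
    secantQuotientAnchorsPinned X' (complexBetti.map e.inv 2 θ) := by
  obtain ⟨w, hw⟩ := h
  exact ⟨_, IsSecantQuotientWeilClassAtPinned.of_iso e.symm hw⟩

/-- **The transport hypothesis `htr` of `…ServedFibreAnchors.exists_servedPencil_of_anchor` ∕ `not_forall_not_hasServedFibre_of_anchor`
HOLDS for the pinned pair `(𝔄^pin, 𝔖^pin)` at `(n, p) = (6, 3)`** — verbatim shape. [cite: Markman2025SecantWeil, §1.5 (p. 7) and Thm. 1.4.1] -/
theorem secantQuotientPinned_transport :
    ∀ ⦃X X' : SchemeOver ℂ⦄ (e : X ≅ X') (θ : complexBetti X 2) (w : complexBetti X (2 * 3)),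
      secantQuotientAnchorsPinned X θ → w ∈ secantQuotientServedClassesPinned X θ →
        secantQuotientAnchorsPinned X' (complexBetti.map e.inv 2 θ) ∧
          complexBetti.map e.inv (2 * 3) w ∈ secantQuotientServedClassesPinned X' (complexBetti.map e.inv 2 θ) :=
  fun _ _ e _ _ h hw ↦ ⟨secantQuotientAnchorsPinned_transport e h, secantQuotientServedClassesPinned_transport e hw⟩

/-- **SERVED FIBRE FROM A CHART, pinned form (what a pinned P1″ consumes).** As `hasServedFibre_secantQuotient_of_chart` with the
pinned predicate: a fibre `𝒳_{sₐ}` which is a chart `e : 𝒳_{sₐ} ≅ X` of `(X, θ)` carrying a PINNED secant–quotient Weil class `w`,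
with `Θ|_{sₐ} = e^*θ` and `W|_{sₐ} = e^*w`, is a pinned-served fibre. Pure transport. [cite: Markman2025SecantWeil, Thm. 1.4.1 and §1.5]
[cite: Bloch1972Semiregularity, Remark (7.5)] -/
theorem hasServedFibre_secantQuotientPinned_of_chart {𝒳 S : SchemeOver ℂ} {f : 𝒳 ⟶ S} {W : complexBetti 𝒳 (2 * 3)}
    (Θ : complexBetti 𝒳 2) (hΘQ : ∀ s : ComplexPoints S, IsRationalClass (complexBetti.map (fiberι f s) 2 Θ))
    (hΘH : ∀ s : ComplexPoints S, IsOfHodgeType 6 (fiberOver f s) 2 1 1 (complexBetti.map (fiberι f s) 2 Θ))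
    (sₐ : ComplexPoints S) {X : SchemeOver ℂ} {θ : complexBetti X 2} {w : complexBetti X (2 * 3)}
    (e : fiberOver f sₐ ≅ X) (hw : IsSecantQuotientWeilClassAtPinned X θ w)
    (hΘ : complexBetti.map (fiberι f sₐ) 2 Θ = complexBetti.map e.hom 2 θ)
    (hW : complexBetti.map (fiberι f sₐ) (2 * 3) W = complexBetti.map e.hom (2 * 3) w) :
    HasServedFibre 6 3 (fun X θ ↦ secantQuotientAnchorsPinned X θ) (fun X θ ↦ secantQuotientServedClassesPinned X θ) f W := by
  refine ⟨sₐ, Θ, hΘQ, hΘH, ?_, ?_⟩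
  · rw [hΘ]; exact ⟨_, hw.of_iso e⟩
  · show complexBetti.map (fiberι f sₐ) (2 * 3) W ∈ secantQuotientServedClassesPinned _ _
    rw [hΘ, hW]; exact hw.of_iso e

/-- **Corollary (the anchor fibre is itself a chart of `Y_d`)**, pinned form. [cite: Markman2025SecantWeil, §1.5 (p. 7)] -/
theorem hasServedFibre_secantQuotientPinned_of_chart_Y {𝒳 S : SchemeOver ℂ} {f : 𝒳 ⟶ S} {W : complexBetti 𝒳 (2 * 3)}
    (Θ : complexBetti 𝒳 2) (hΘQ : ∀ s : ComplexPoints S, IsRationalClass (complexBetti.map (fiberι f s) 2 Θ))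
    (hΘH : ∀ s : ComplexPoints S, IsOfHodgeType 6 (fiberOver f s) 2 1 1 (complexBetti.map (fiberι f s) 2 Θ))
    (sₐ : ComplexPoints S) (D : SecantQuotientDatum) {θ : complexBetti D.Y.X 2} {w : complexBetti D.Y.X (2 * 3)}
    (e : fiberOver f sₐ ≅ D.Y.X) (hw : w ∈ secantQuotientServedClassesPinned D.Y.X θ)
    (hΘ : complexBetti.map (fiberι f sₐ) 2 Θ = complexBetti.map e.hom 2 θ)
    (hW : complexBetti.map (fiberι f sₐ) (2 * 3) W = complexBetti.map e.hom (2 * 3) w) :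
    HasServedFibre 6 3 (fun X θ ↦ secantQuotientAnchorsPinned X θ) (fun X θ ↦ secantQuotientServedClassesPinned X θ) f W :=
  hasServedFibre_secantQuotientPinned_of_chart Θ hΘQ hΘH sₐ e hw hΘ hW

/-! ## §7 Link to the carriers' scheme-level anchor shape `Markman2025.IsSecantQuotientAnchorWith` -/

/-- **A pinned anchor has the carriers' shape `IsSecantQuotientAnchorWith D.d X θ`** (`θ = e^*h_Y(θ₀)`, `θ₀ ∈ ℚˣ·[Θ]`), for the
datum and chart of the pin — so F5's API (smooth projective `6`-fold; `θ` rational, `≠ 0`, of type `(1,1)`, algebraic) applies at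
every pinned anchor. [cite: Markman2025SecantWeil, §1.3 (p. 5), §1.5 (p. 7) and §3.2 Cor. 3.2.3] -/
theorem IsSecantQuotientWeilClassAtPinned.exists_isSecantQuotientAnchorWith (h : IsSecantQuotientWeilClassAtPinned X θ γ) :
    ∃ d : ℕ, Even d ∧ 4 ≤ d ∧ IsSecantQuotientAnchorWith d X θ := by
  obtain ⟨D, e, θ₀, hθ₀, hpin, -⟩ := h
  refine ⟨D.d, D.even, D.four_le, ?_⟩
  have hθ : θ = complexBetti.map e.hom 2 (D.hY θ₀) := by
    rw [← hpin, e.complexBetti_map_hom_map_inv]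
  rw [hθ]
  exact isSecantQuotientAnchorWith_map D.smooth D.𝒥 D.dim_J D.riemann D.principal hθ₀ D.G₁_le D.G₂_le
    D.cyclic₁ D.card₁ D.cyclic₂ D.card₂ D.disjoint e

/-- A pinned anchor `(X, θ)` has the carriers' shape for some even level `d ≥ 4`. [cite: Markman2025SecantWeil, §1.5 (p. 7)] -/
theorem exists_isSecantQuotientAnchorWith_of_secantQuotientAnchorsPinned (h : secantQuotientAnchorsPinned X θ) :
    ∃ d : ℕ, Even d ∧ 4 ≤ d ∧ IsSecantQuotientAnchorWith d X θ := by
  obtain ⟨γ, hγ⟩ := h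
  exact hγ.exists_isSecantQuotientAnchorWith

end Summit.HodgeConjecture.HodgeConjecture.Ring2.SemiregularRepresentatives

end
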